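import Mathlib

/-!
# Line `negsquares` — THEOREM E of memo PART II §23 (trop-IB*(2,K) ≤ K−1 for every K): the FINITARY CORE in kernel

Ideator seat `val-idea-6`, generation 14 (v1.0a, 2026-08-29; v1.0 graded PASS by val-idea-crit-1 #168 and val-idea-crit-2 #60; v1.0a = + the
`dupNamespace` linter option, no content change).  Crux `MatrixDescartes` (stmt-18050) is NOT touched; `VP ≠ VNP` is not
moved; the file has NO `sorry` and registers nothing.  Companion files: `Lines/negsquares-kink-II.md` §23 (the paper proof, PASSED as a
theorem by val-idea-crit-1 #157 and val-idea-crit-2 #58), `Lines/negsquares_inflection.lean` (the inflection law IB(m,K)).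

WHAT IS HERE (asked for by crit-2 #58 (a) / crit-1 #157: «formalise Theorem E over the finite TRANSITION ALPHABET, not over real
configurations»).  Theorem E says: for a generic two-letter tropical configuration on slopes `d₁ < … < d_K`, if the t-th *-piece starts
with (active, inactive) dominant indices `(P_t, Q_t)` and MIDPOINT `m_t = (d_{P_t} + d_{Q_t})/2`, then some support slope lies strictly
between `m_t` and `m_{t+1}`; hence the MIDPOINT RANK `ρ_t = #{l : d_l < m_t}` satisfies `ρ_{t+1} ≥ ρ_t + 1`, `ρ_t ≥ t`, and the number of
*-pieces is `≤ K − 1`.  The proof has two layers: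
* (SEMANTIC, paper only: §20.2 L1/L2, the slope certificates (CERT)/(★) of §21, the dip window `4z² − 4z − 1 < 0` of Theorem A through
  `κ < 1`) — every pair of consecutive piece starts is one of nine TRANSITIONS, each delivering a small system of order facts and at most one
  slope inequality between the indices involved;
* (ARITHMETIC, this file) — §1 the midpoint rank and its monotonicity under a witness; §2 the STAIRCASE: consecutive witnesses force
  `N ≤ K − 1` (`pieces_le`, with the invariant `rank_staircase : t + 1 ≤ ρ(m_t)`); §3 the NINE WITNESS LEMMAS, one per transition of
  §23.2 (D0 types I/II/III, D1, R0 (i), (ii) ×3, (iii) ×2, R1 ×4 — several share a lemma), each the statement «the named slope lies strictly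
  between the two midpoints» from exactly the hypotheses the semantic layer provides.  Slopes are rationals here (the tropical engine is
  exact over ℚ); every lemma holds verbatim over any linear ordered field.
HONEST LABEL: this certifies the bookkeeping and every inequality manipulation of §23.2; it does NOT certify that tropical configurations
produce transition words with these hypotheses (that is the paper layer above, checked by two critics and by three independent exact engines
on ≈ 30 000 configurations, 0 violations).
-/

set_option linter.dupNamespace false  -- the mandated `Summit.ValiantsHypothesis.ValiantsHypothesis.…` prefix (crit-2 #60)

namespace Summit.ValiantsHypothesis.ValiantsHypothesis.Cruxes.MatrixDescartes.NegSquaresTropE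

/-! ## §1 The midpoint rank -/

variable {K : ℕ}

/-- midpoint rank `ρ(m) = #{l : d_l < m}` of a level `m` with respect to the support `d : Fin K → ℚ`. -/
def mrank (d : Fin K → ℚ) (m : ℚ) : ℕ := (Finset.univ.filter (fun l => d l < m)).card

theorem mrank_mono (d : Fin K → ℚ) {m m' : ℚ} (h : m ≤ m') : mrank d m ≤ mrank d m' := by
  unfold mrank
  apply Finset.card_le_card
  intro l hl
  simp only [Finset.mem_filter, Finset.mem_univ, true_and] at hl ⊢
  exact lt_of_lt_of_le hl h

/-- A support slope strictly between two levels raises the rank (the one-line heart of Theorem E). -/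
theorem mrank_lt_of_witness (d : Fin K → ℚ) {m m' : ℚ} (w : Fin K)
    (h1 : m < d w) (h2 : d w < m') : mrank d m < mrank d m' := by
  unfold mrank
  apply Finset.card_lt_card
  refine ⟨?_, ?_⟩
  · intro l hl
    simp only [Finset.mem_filter, Finset.mem_univ, true_and] at hl ⊢
    exact hl.trans (h1.trans h2)
  · intro hsub
    have hw : w ∈ Finset.univ.filter (fun l => d l < m') := by
      simp only [Finset.mem_filter, Finset.mem_univ, true_and]; exact h2
    have hw' := hsub hw
    simp only [Finset.mem_filter, Finset.mem_univ, true_and] at hw'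
    exact absurd hw' (not_lt.mpr h1.le)

/-- A level weakly below some slope has rank `≤ K − 1`. -/
theorem mrank_le_pred (d : Fin K → ℚ) {m : ℚ} (h : ∃ l, m ≤ d l) : mrank d m ≤ K - 1 := by
  obtain ⟨l, hl⟩ := h
  have hlt : mrank d m < K := by
    have hss : Finset.univ.filter (fun l => d l < m) ⊂ (Finset.univ : Finset (Fin K)) := by
      refine ⟨Finset.filter_subset _ _, ?_⟩
      intro hsub
      have := hsub (Finset.mem_univ l)
      simp only [Finset.mem_filter, Finset.mem_univ, true_and] at this
      exact absurd this (not_lt.mpr hl)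
    have := Finset.card_lt_card hss
    simpa [mrank] using this
  omega

/-- A level strictly above some slope has rank `≥ 1`. -/
theorem one_le_mrank (d : Fin K → ℚ) {m : ℚ} (h : ∃ l, d l < m) : 1 ≤ mrank d m := by
  obtain ⟨l, hl⟩ := h
  have : 0 < mrank d m := by
    unfold mrank
    apply Finset.card_pos.mpr
    exact ⟨l, by simp only [Finset.mem_filter, Finset.mem_univ, true_and]; exact hl⟩
  omega

/-! ## §2 The staircase (THEOREM E, counting half) -/

/-- The INVARIANT of §23: with a slope below the first midpoint and a witness slope strictly between every two consecutive
midpoints, the t-th midpoint has rank `≥ t + 1` (pieces indexed from `0`; memo: `ρ_t ≥ t` with pieces from `1`). -/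
theorem rank_staircase (d : Fin K → ℚ) (N : ℕ) (m : ℕ → ℚ)
    (hlow : ∃ l, d l < m 0)
    (hw : ∀ t, t + 1 < N → ∃ w, m t < d w ∧ d w < m (t + 1)) :
    ∀ t, t < N → t + 1 ≤ mrank d (m t) := by
  intro t
  induction t with
  | zero =>
    intro _
    have := one_le_mrank d hlow
    omega
  | succ t ih =>
    intro ht
    obtain ⟨w, h1, h2⟩ := hw t ht
    have hlt := mrank_lt_of_witness d w h1 h2
    have hih := ih (by omega)
    omega

/-- THEOREM E (counting half): `N` pieces whose midpoints `m 0, …, m (N−1)` admit a slope below the first, a slope weakly above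
the last, and a witness slope strictly between every two consecutive ones, number at most `K − 1`. -/
theorem pieces_le (d : Fin K → ℚ) (N : ℕ) (m : ℕ → ℚ)
    (hlow : ∃ l, d l < m 0)
    (hhigh : ∀ t, t < N → ∃ l, m t ≤ d l)
    (hw : ∀ t, t + 1 < N → ∃ w, m t < d w ∧ d w < m (t + 1)) :
    N ≤ K - 1 := by
  rcases Nat.eq_zero_or_pos N with h0 | hpos
  · omega
  · have h1 := rank_staircase d N m hlow hw (N - 1) (by omega)
    have h2 := mrank_le_pred d (hhigh (N - 1) (by omega))
    omega

/-- In the tropical setting every midpoint is `(d_P + d_Q)/2` with `P ≠ Q`, so `hlow`/`hhigh` hold automatically: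
the smaller index is strictly below, the larger weakly (indeed strictly) above. -/
theorem midpoint_between {dP dQ : ℚ} (h : dQ < dP) : dQ < (dP + dQ) / 2 ∧ (dP + dQ) / 2 ≤ dP := by
  constructor <;> linarith

/-! ## §3 The nine witness lemmas of §23.2 (one per transition; `m_t = (dP + dQ)/2` throughout, `Q` inactive, `P` active)

Notation: `dP, dQ` the slopes of the active / inactive dominant indices at the start of piece `t`; primed letters at the start of
piece `t+1`; `da < db` the slopes of a jump `a → b`; `dPs` = `d_{P⁺}` (the active letter's next index), `dp` = `d_{p_u(r)}`;
`dpe`, `dPm` = `d_{p(e)}`, `d_{P′⁻}` in the certificate (★).  Index order facts enter as (weak or strict) slope inequalities. -/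

/-- D0, type I dip (`Q ≤ a < P < b`, jumper = inactive letter): witness `P`.  Also R0 (i) (E-entry from below, E-exit above:
`Q < P < Q′`, `P′ = P`) with `db := dQ′`. -/
theorem wit_typeI {dP dQ db : ℚ} (hQP : dQ < dP) (hPb : dP < db) :
    (dP + dQ) / 2 < dP ∧ dP < (dP + db) / 2 := by
  constructor <;> linarith

/-- D0, type II dip (`Q ≤ a < b < P`; dip window through `κ < 1`: `dP − db < db − da`): witness `b`. -/
theorem wit_typeII {dP dQ da db : ℚ} (hQa : dQ ≤ da) (hbP : db < dP) (hdip : dP - db < db - da) :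
    (dP + dQ) / 2 < db ∧ db < (dP + db) / 2 := by
  constructor <;> linarith

/-- D0, type III dip (`P < a < b`, `Q ≤ a`; dip window `da − dP < db − da`): witness `a`. -/
theorem wit_typeIII {dP dQ da db : ℚ} (hQa : dQ ≤ da) (hPa : dP < da) (hdip : da - dP < db - da) :
    (dP + dQ) / 2 < da ∧ da < (dP + db) / 2 := by
  constructor <;> linarith

/-- D1: a crossing inside piece `t` (activity handed DOWN to the cell `Q_c < P`), then a dip = jump `a → b` of the now-inactive letter with
`a ≥ P`, type III w.r.t. `Q_c` (`da − dQc < db − da`); new midpoint `(dQc + db)/2`: witness `a`. -/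
theorem wit_D1 {dP dQ dQc da db : ℚ} (hQP : dQ < dP) (hPa : dP ≤ da) (hdip : da - dQc < db - da) :
    (dP + dQ) / 2 < da ∧ da < (dQc + db) / 2 := by
  constructor <;> linarith

/-- R0 (ii), `Q > P` (the active letter jumps past the inactive one: `Q ≤ Q′ < P′`): witness `Q`. -/
theorem wit_R0ii_above {dP dQ dP' dQ' : ℚ} (hPQ : dP < dQ) (hQQ' : dQ ≤ dQ') (hQ'P' : dQ' < dP') :
    (dP + dQ) / 2 < dQ ∧ dQ < (dP' + dQ') / 2 := by
  constructor <;> linarith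

/-- R0 (ii), `Q < P`, piece `t` ends by E-entry (`Q′ ≥ P`, `P′ > P`): witness `P`.  Also R1 / G-entry with `Q′ < P′`
(`dQ < dP ≤ dQ′ < dP′`). -/
theorem wit_R0ii_entry {dP dQ dP' dQ' : ℚ} (hQP : dQ < dP) (hPQ' : dP ≤ dQ') (hPP' : dP < dP') :
    (dP + dQ) / 2 < dP ∧ dP < (dP' + dQ') / 2 := by
  constructor <;> linarith

/-- R0 (ii), `Q < P`, piece `t` ends by G-exit; certificate (CERT) `d_{P⁺} − d_P > d_P − d_{p_u(r)}` with `P′ ≥ P⁺`, `Q′ ≥ p_u(r)`: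
witness `P`. -/
theorem wit_R0ii_cert {dP dQ dP' dQ' dPs dp : ℚ} (hQP : dQ < dP) (hcert : dPs - dP > dP - dp)
    (h1 : dPs ≤ dP') (h2 : dp ≤ dQ') :
    (dP + dQ) / 2 < dP ∧ dP < (dP' + dQ') / 2 := by
  constructor <;> linarith

/-- R0 (iii) with `Q ≤ P′` (`P < P′ < Q′`): witness `P′`.  Also R1 / E-exit and R1 / G-entry with `p_v(e) ≤ P′`
(`dQ < dP ≤ dP′ < dQ′`, apply with the roles of the two order hypotheses exchanged: see `wit_R1_exit`). -/
theorem wit_R0iii_below {dP dQ dP' dQ' : ℚ} (hPP' : dP < dP') (hQP' : dQ ≤ dP') (hP'Q' : dP' < dQ') :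
    (dP + dQ) / 2 < dP' ∧ dP' < (dP' + dQ') / 2 := by
  constructor <;> linarith

/-- R1 / E-exit, and R1 / G-entry with `p_v(e) ≤ P′`: `dQ < dP ≤ dP′ < dQ′`: witness `P′`. -/
theorem wit_R1_exit {dP dQ dP' dQ' : ℚ} (hQP : dQ < dP) (hPP' : dP ≤ dP') (hP'Q' : dP' < dQ') :
    (dP + dQ) / 2 < dP' ∧ dP' < (dP' + dQ') / 2 := by
  constructor <;> linarith

/-- The certificate (★) cases — R0 (iii) with `Q > P′` (`dpe ≥ dQ`, `dPm ≥ dP`) and R1 / G-entry with `p_v(e) > P′`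
(`dpe ≥ dP`, `dPm ≥ dQc ≥ dQ`): in both `dP + dQ ≤ dpe + dPm`, and (★) `d_{P′} − d_{P′⁻} > d_{p(e)} − d_{P′}` gives `2 d_{P′} > dpe + dPm`:
witness `P′`. -/
theorem wit_star {dP dQ dP' dQ' dpe dPm : ℚ} (hstar : dP' - dPm > dpe - dP') (hsum : dP + dQ ≤ dpe + dPm)
    (hP'Q' : dP' < dQ') :
    (dP + dQ) / 2 < dP' ∧ dP' < (dP' + dQ') / 2 := by
  constructor <;> linarith

/-! ## §4 How §2 and §3 assemble (a worked packaging over an abstract transition word)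

A TRANSITION WORD of length `N` records, for each `t`, the two midpoints and a witness slope with the strict double inequality — which is
exactly what each lemma of §3 outputs.  `pieces_le` then bounds `N`.  The corollary below is the form the paper proof uses: pieces
are given by index pairs `(P t, Q t)` into the support with `P t ≠ Q t`, and consecutive pairs come with a witness index. -/

/-- THEOREM E over index data: pieces `t < N` with dominant index pairs `P t ≠ Q t` (as slopes: `d (P t) ≠ d (Q t)`) and, for
consecutive pieces, a witness index strictly between the midpoints ⇒ `N ≤ K − 1`. -/
theorem tropPieces_le (d : Fin K → ℚ) (N : ℕ) (P Q : ℕ → Fin K)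
    (hne : ∀ t, t < N → d (P t) ≠ d (Q t))
    (hw : ∀ t, t + 1 < N → ∃ w : Fin K,
        (d (P t) + d (Q t)) / 2 < d w ∧ d w < (d (P (t + 1)) + d (Q (t + 1))) / 2) :
    N ≤ K - 1 := by
  rcases Nat.eq_zero_or_pos N with h0 | hpos
  · omega
  apply pieces_le d N (fun t => (d (P t) + d (Q t)) / 2)
  · -- a slope below the first midpoint: the smaller of d (P 0), d (Q 0)
    rcases lt_or_gt_of_ne (hne 0 hpos) with h | h
    · exact ⟨P 0, by linarith⟩
    · exact ⟨Q 0, by linarith⟩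
  · intro t ht
    rcases lt_or_gt_of_ne (hne t ht) with h | h
    · exact ⟨Q t, by linarith⟩
    · exact ⟨P t, by linarith⟩
  · exact hw

end Summit.ValiantsHypothesis.ValiantsHypothesis.Cruxes.MatrixDescartes.NegSquaresTropE
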